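import Literature.NumberTheory.Rogawski1990.ArchCompactWallCentralizerAverage    -- ★ p842668∕p842697 (A2″) part 1 (this seat): compact centraliser, joint continuity∕support tools (brings ★ (A2′))
import Literature.NumberTheory.Rogawski1990.ArchCompactWallTransversalHessian      -- ★ p843070 (A2″) part 2a (this seat): Hessian + gradient at every conjugate
import Literature.LinearAlgebra.Matrix.UnitaryBlockPauliFrameRotations             -- (A2″) part 2b-I′ (this seat): the two block rotations
import Mathlib.Tactic.Module
import HarnessLib

/-!
# ROAD A (A2″) part 2b-II(a) — THE PAULI FRAME INSIDE THE COMPACT CENTRALISER: integrability of the transversal second derivative along a fixed conjugate, the pointwise wall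
# formula in Pauli form, and the frame elements `1, m₂, m₃ ∈ Z(t₀)`
# (Rogawski 1990 §8.4 p. 126; the input of the `H²_ℂ` hat-box chart ★ (A3-a)–(A3-c′) and of the (A4) value, F0P3a-p05 census 19b229d9 §2)

Topic `NumberTheory/Automorphic`; namespace `Literature.NumberTheory.Automorphic.UnitaryGroup`.  THEOREMS ONLY (no `def`, no instance, no notation, no axiom, no named fact, no
`sorry`).  Cell `pub/hodgecm-mathlib`, ENGINE T1 (crux H413 = `stmt-HodgeConjecture-24833`); ROAD A toward the (L_{U(2,1)}) letter N1 `stub_ArchCentralLimitU21` (owner F0P3a-p05;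
chair F0P3a-plan WORD T9-8 (D) «(A2″) part 2 = ball-chart form»); brick **(A2″) part 2b-II(a)** (§1–§3; the trace form itself is part 2b-II(b) `ArchCompactWallTransversalTrace`), over ★ part 1, ★ part 2a and the two linear-algebra files 2b-I∕2b-I′;
author A-p14 (g28).

THE MATHEMATICS.  `G_w = archLocal L N (diagonal α) w` (`e_k = σ_w(α_k)` real non-zero), a compact-wall point `t₀ = diag ζ` (`i ≠ j`, `ζ_i = ζ_j`, the `b`-block of `i` is `{i,j}`, and — for the
frame — `e_i = e_j`, so that the `(i,j)`-block of `Z(t₀)` is an honest `U(2)`), the Pauli frame `y₁ = i(E_ii − E_jj)`, `y₂ = E_ij − E_ji`, `y₃ = i(E_ij + E_ji)`, `h_g = ↑↑(g t₀ g⁻¹)`,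
`Q_g = ↑↑g (E_ii + E_jj) ↑↑g⁻¹`, `Ad(g)Y = ↑↑g · Y · ↑↑g⁻¹`.
* §1 for every `u ∈ G_w` the transversal second derivative `g ↦ ∂²_y|₀ Θ(↑↑(g (u t_y u⁻¹) g⁻¹))` is CONTINUOUS with COMPACT SUPPORT, hence integrable (★ (C-cw) uniform support + ★ Hörmander
  `continuous_iteratedFDeriv_comp_affine_param`; as in ★ part 1 §4, now for fixed `u`).
* §2 the pointwise formula of ★ 2a in PAULI FORM: for `m ∈ Z(t₀)`, `∂²_y|₀ Θ(↑↑(g (m t_y m⁻¹) g⁻¹)) = D²Θ(h_g)[ζ_i • Ad(g)(Ad(m) y₁)]² − DΘ(h_g)[ζ_i • Q_g]`.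
* §3 **`exists_frame_rotations_mem_centralizer`**: two elements `m₂, m₃ ∈ Z(t₀) ≤ G_w` with `Ad(m₂) y₁ = y₃`, `Ad(m₃) y₁ = y₂` (the rotations `R(1∕√2)`, `S(1∕√2)` of 2b-I′).
* §4–§5 (the trace form `N²Φ = ∫(⅓Σ_a D²Θ(h_g)[ζ_i•Ad(g)y_a]² − DΘ(h_g)[ζ_i•Q_g]) dν` and its right-`Z(t₀)`-invariance) are in part 2b-II(b).
HONEST LABEL: HC_CM is proved only modulo the printed citations until rung 0 closes; calculus, matrix algebra and bookkeeping, pays nothing by itself.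

## References
* [Rogawski1990] J. D. Rogawski, *Automorphic Representations of Unitary Groups in Three Variables*, Ann. of Math. Stud. 123 (1990), §8.2 pp. 122–123, §8.4 p. 126.
* [Varadarajan1989] V. S. Varadarajan, *An Introduction to Harmonic Analysis on Semisimple Lie Groups* (1989), §6.4 (second-order germs of orbital integrals at singular points; `G∕K` reduction).
* [Helgason2000] S. Helgason, *Groups and Geometric Analysis* (2000), Ch. II §4 (radial parts; spherical averages of quadratic forms, `∫_{S²}(n·σ)⊗(n·σ)dσ = ⅓Σσ_a⊗σ_a`).
* [HormanderALPDO1] L. Hörmander, *The Analysis of Linear Partial Differential Operators I*, Thm. 1.1.9.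
-/

set_option autoImplicit false

noncomputable section

open MeasureTheory Measure Filter Topology Set Function Metric NumberField NumberField.InfinitePlace Complex
open scoped ContDiff ComplexConjugate

namespace Literature.NumberTheory.Automorphic.UnitaryGroup

open Literature.Analysis.Calculus
open scoped _root_.Matrix MatrixGroups   -- `_root_`: inside `namespace Literature.…` the bare `Matrix` resolves to a `Literature.…Matrix` namespace and the `ᵀ`∕`ᴴ` notations would not open
open scoped Matrix.Norms.Operator

/-! ## §1 Integrability in `g` of the transversal second derivative along a fixed conjugate -/

section Integrable

variable (L : Type) [Field L] (N : ℕ) (α : Fin N → L) (w : {w : InfinitePlace L // IsComplex w})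
  {E : Type*} [NormedAddCommGroup E] [NormedSpace ℝ E]

/-- **CONTINUITY IN `g`** of the transversal second derivative `g ↦ ∂²_y|₀ Θ(↑↑(g·(u t_y u⁻¹)·g⁻¹))` for `Θ` smooth and any `u ∈ G_w` (the `y`-germ is `Ψ(L y + c(g))` with `Ψ` jointly smooth and
`c` continuous; ★ Hörmander `continuous_iteratedFDeriv_comp_affine_param`). [cite: HormanderALPDO1, Thm. 1.1.9] -/
theorem continuous_iteratedDeriv_two_comp_conj_conj_wallLine (Θ : Matrix (Fin N) (Fin N) ℂ → E) (hΘ : ContDiff ℝ ∞ Θ)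
    (ζ : Fin N → Circle) (i j : Fin N) (u : archLocal L N (Matrix.diagonal α) w) :
    Continuous fun g : archLocal L N (Matrix.diagonal α) w => iteratedDeriv 2 (fun y : ℝ =>
      Θ ((((g * (u * ⟨circleDiagonal N fun k => ζ k * Circle.exp (y * ((if k = i then 1 else 0) - (if k = j then 1 else 0))),
        circleDiagonal_mem_archLocal_diagonal L N α w _⟩ * u⁻¹) * g⁻¹ : archLocal L N (Matrix.diagonal α) w) : GL (Fin N) ℂ) : Matrix (Fin N) (Fin N) ℂ))) 0 := by
  have hline : ContDiff ℝ ∞ fun y : ℝ => fun k : Fin N => y * ((if k = i then (1:ℝ) else 0) - (if k = j then 1 else 0)) :=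
    contDiff_pi.2 fun k => contDiff_id.mul contDiff_const
  -- the jointly smooth presentation `Ψ (Lr y + c g)`, `c g = ((↑↑(g u), ↑↑(g u)⁻¹), 0)`
  obtain ⟨Ψ, hΨ⟩ : ∃ Ψ : (Matrix (Fin N) (Fin N) ℂ × Matrix (Fin N) (Fin N) ℂ) × ℝ → E, Ψ =
      fun q => Θ (q.1.1 * ((circleDiagonal N fun k => ζ k * Circle.exp (q.2 * ((if k = i then (1:ℝ) else 0) - (if k = j then 1 else 0))) :
        GL (Fin N) ℂ) : Matrix (Fin N) (Fin N) ℂ) * q.1.2) := ⟨_, rfl⟩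
  have hΨd : ContDiff ℝ ∞ Ψ := by
    rw [hΨ]
    exact hΘ.comp (((contDiff_fst.comp contDiff_fst).mul (((contDiff_coe_circleDiagonal_angles N ζ).comp hline).comp contDiff_snd)).mul (contDiff_snd.comp contDiff_fst))
  obtain ⟨c, hc⟩ : ∃ c : archLocal L N (Matrix.diagonal α) w → (Matrix (Fin N) (Fin N) ℂ × Matrix (Fin N) (Fin N) ℂ) × ℝ, c =
      fun g => (((((g * u : archLocal L N (Matrix.diagonal α) w) : GL (Fin N) ℂ) : Matrix (Fin N) (Fin N) ℂ),
        ((((g * u)⁻¹ : archLocal L N (Matrix.diagonal α) w) : GL (Fin N) ℂ) : Matrix (Fin N) (Fin N) ℂ)), (0 : ℝ)) := ⟨_, rfl⟩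
  have hgu : Continuous fun g : archLocal L N (Matrix.diagonal α) w => g * u := continuous_id.mul continuous_const
  have hcc : Continuous c := by
    rw [hc]
    exact (((Units.continuous_val.comp continuous_subtype_val).comp hgu).prodMk
      (((Units.continuous_val.comp continuous_subtype_val).comp continuous_inv).comp hgu)).prodMk continuous_const
  obtain ⟨Lr, hLr⟩ : ∃ Lr : ℝ →L[ℝ] (Matrix (Fin N) (Fin N) ℂ × Matrix (Fin N) (Fin N) ℂ) × ℝ, Lr = ContinuousLinearMap.inr ℝ _ ℝ := ⟨_, rfl⟩
  have hconj : ∀ (g : archLocal L N (Matrix.diagonal α) w) (y : ℝ),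
      g * (u * ⟨circleDiagonal N fun k => ζ k * Circle.exp (y * ((if k = i then 1 else 0) - (if k = j then 1 else 0))), circleDiagonal_mem_archLocal_diagonal L N α w _⟩ * u⁻¹) * g⁻¹ =
        (g * u) * ⟨circleDiagonal N fun k => ζ k * Circle.exp (y * ((if k = i then 1 else 0) - (if k = j then 1 else 0))), circleDiagonal_mem_archLocal_diagonal L N α w _⟩ * (g * u)⁻¹ := by
    intro g y
    rw [_root_.mul_inv_rev]; simp only [mul_assoc]
  have hpres : ∀ g : archLocal L N (Matrix.diagonal α) w, (fun y : ℝ =>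
      Θ ((((g * (u * ⟨circleDiagonal N fun k => ζ k * Circle.exp (y * ((if k = i then 1 else 0) - (if k = j then 1 else 0))),
        circleDiagonal_mem_archLocal_diagonal L N α w _⟩ * u⁻¹) * g⁻¹ : archLocal L N (Matrix.diagonal α) w) : GL (Fin N) ℂ) : Matrix (Fin N) (Fin N) ℂ))) =
      fun y => Ψ (Lr y + c g) := by
    intro g; funext y
    rw [hconj]
    simp only [hΨ, hc, hLr, ContinuousLinearMap.inr_apply, Prod.mk_add_mk, zero_add, add_zero, coe_conj_archLocal]
  have h2 := continuous_iteratedFDeriv_comp_affine_param hΨd Lr hcc 2 (0 : ℝ)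
  have hF' : (fun g : archLocal L N (Matrix.diagonal α) w => iteratedDeriv 2 (fun y : ℝ =>
      Θ ((((g * (u * ⟨circleDiagonal N fun k => ζ k * Circle.exp (y * ((if k = i then 1 else 0) - (if k = j then 1 else 0))),
        circleDiagonal_mem_archLocal_diagonal L N α w _⟩ * u⁻¹) * g⁻¹ : archLocal L N (Matrix.diagonal α) w) : GL (Fin N) ℂ) : Matrix (Fin N) (Fin N) ℂ))) 0) =
      fun g => (iteratedFDeriv ℝ 2 (fun y : ℝ => Ψ (Lr y + c g)) 0) (fun _ => 1) := by
    funext g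
    rw [iteratedDeriv_eq_iteratedFDeriv, hpres g]
  rw [hF']
  exact (ContinuousMultilinearMap.apply ℝ (fun _ : Fin 2 => ℝ) E (fun _ => 1)).continuous.comp h2

/-- **COMPACT SUPPORT IN `g`**: under the (C-cw) hypotheses (`e_k` real non-zero, constant-sign labelling `b`, `ζ` block-separated, `Θ` compactly supported on `G_w`) the same function
vanishes off the compact `S·u⁻¹`, `S` the uniform support compact of ★ `exists_closedBall_isCompact_apply_conj_circleDiagonal_angles_eq_zero_of_blocks` (the `y`-germ is identically `0` there).
[cite: Rogawski1990, §8.2 p. 122] -/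
theorem hasCompactSupport_iteratedDeriv_two_comp_conj_conj_wallLine (hα : ∀ i, α i ≠ 0) (hreal : ∀ i, (w.1.embedding (α i)).im = 0)
    {ι : Type*} (b : Fin N → ι) (hsign : ∀ i j, i ≠ j → b i = b j → 0 < (w.1.embedding (α i)).re * (w.1.embedding (α j)).re)
    (Θ : Matrix (Fin N) (Fin N) ℂ → E) (hfc : HasCompactSupport fun k : archLocal L N (Matrix.diagonal α) w => Θ (((k : GL (Fin N) ℂ) : Matrix (Fin N) (Fin N) ℂ)))
    (ζ : Fin N → Circle) (hζ : ∀ k l, b k ≠ b l → ζ k ≠ ζ l) (i j : Fin N) (u : archLocal L N (Matrix.diagonal α) w) :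
    HasCompactSupport fun g : archLocal L N (Matrix.diagonal α) w => iteratedDeriv 2 (fun y : ℝ =>
      Θ ((((g * (u * ⟨circleDiagonal N fun k => ζ k * Circle.exp (y * ((if k = i then 1 else 0) - (if k = j then 1 else 0))),
        circleDiagonal_mem_archLocal_diagonal L N α w _⟩ * u⁻¹) * g⁻¹ : archLocal L N (Matrix.diagonal α) w) : GL (Fin N) ℂ) : Matrix (Fin N) (Fin N) ℂ))) 0 := by
  obtain ⟨δ, hδ, S, hS, hS0⟩ := exists_closedBall_isCompact_apply_conj_circleDiagonal_angles_eq_zero_of_blocks L N α w hα hreal b hsign Θ hfc ζ 0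
    (fun k l hkl => by simpa only [Pi.zero_apply, Circle.exp_zero, mul_one] using hζ k l hkl)
  -- off `S·u⁻¹` the `y`-germ vanishes
  have hK : IsCompact ((fun s : archLocal L N (Matrix.diagonal α) w => s * u⁻¹) '' S) := hS.image (continuous_id.mul continuous_const)
  refine HasCompactSupport.intro hK fun g hg => ?_
  have hnot : g * u ∉ S := fun hmem => hg ⟨g * u, hmem, by simp only [mul_inv_cancel_right]⟩
  have hconj : ∀ y : ℝ,
      g * (u * ⟨circleDiagonal N fun k => ζ k * Circle.exp (y * ((if k = i then 1 else 0) - (if k = j then 1 else 0))), circleDiagonal_mem_archLocal_diagonal L N α w _⟩ * u⁻¹) * g⁻¹ =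
        (g * u) * ⟨circleDiagonal N fun k => ζ k * Circle.exp (y * ((if k = i then 1 else 0) - (if k = j then 1 else 0))), circleDiagonal_mem_archLocal_diagonal L N α w _⟩ * (g * u)⁻¹ := by
    intro y
    rw [_root_.mul_inv_rev]; simp only [mul_assoc]
  have hlc : Continuous fun y : ℝ => fun k : Fin N => y * ((if k = i then (1:ℝ) else 0) - (if k = j then 1 else 0)) :=
    continuous_pi fun k => continuous_id.mul continuous_const
  have hU : (fun y : ℝ => fun k : Fin N => y * ((if k = i then (1:ℝ) else 0) - (if k = j then 1 else 0))) ⁻¹' Metric.closedBall 0 δ ∈ 𝓝 (0 : ℝ) := by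
    refine hlc.continuousAt.preimage_mem_nhds ?_
    have h00 : (fun k : Fin N => (0 : ℝ) * ((if k = i then (1:ℝ) else 0) - (if k = j then 1 else 0))) = 0 := funext fun k => by
      rw [zero_mul]; rfl
    rw [h00]
    exact Metric.closedBall_mem_nhds 0 hδ
  have hzero : (fun y : ℝ => Θ ((((g * (u * ⟨circleDiagonal N fun k => ζ k * Circle.exp (y * ((if k = i then 1 else 0) - (if k = j then 1 else 0))),
        circleDiagonal_mem_archLocal_diagonal L N α w _⟩ * u⁻¹) * g⁻¹ : archLocal L N (Matrix.diagonal α) w) : GL (Fin N) ℂ) : Matrix (Fin N) (Fin N) ℂ))) =ᶠ[𝓝 0]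
        fun _ => (0 : E) := by
    filter_upwards [hU] with y hy
    rw [hconj]
    exact hS0 (g * u) hnot _ hy
  show iteratedDeriv 2 _ 0 = 0
  rw [hzero.iteratedDeriv_eq 2, iteratedDeriv_const]
  simp

/-- **INTEGRABILITY** of `g ↦ ∂²_y|₀ Θ(↑↑(g·(u t_y u⁻¹)·g⁻¹))` against every measure finite on compacts (continuous with compact support, §1). [cite: Rogawski1990, §8.2 p. 122] -/
theorem integrable_iteratedDeriv_two_comp_conj_conj_wallLine (hα : ∀ i, α i ≠ 0) (hreal : ∀ i, (w.1.embedding (α i)).im = 0)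
    {ι : Type*} (b : Fin N → ι) (hsign : ∀ i j, i ≠ j → b i = b j → 0 < (w.1.embedding (α i)).re * (w.1.embedding (α j)).re)
    [MeasurableSpace (archLocal L N (Matrix.diagonal α) w)] [BorelSpace (archLocal L N (Matrix.diagonal α) w)]
    (ν : Measure (archLocal L N (Matrix.diagonal α) w)) [IsFiniteMeasureOnCompacts ν]
    (Θ : Matrix (Fin N) (Fin N) ℂ → E) (hΘ : ContDiff ℝ ∞ Θ) (hfc : HasCompactSupport fun k : archLocal L N (Matrix.diagonal α) w => Θ (((k : GL (Fin N) ℂ) : Matrix (Fin N) (Fin N) ℂ)))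
    (ζ : Fin N → Circle) (hζ : ∀ k l, b k ≠ b l → ζ k ≠ ζ l) (i j : Fin N) (u : archLocal L N (Matrix.diagonal α) w) :
    Integrable (fun g : archLocal L N (Matrix.diagonal α) w => iteratedDeriv 2 (fun y : ℝ =>
      Θ ((((g * (u * ⟨circleDiagonal N fun k => ζ k * Circle.exp (y * ((if k = i then 1 else 0) - (if k = j then 1 else 0))),
        circleDiagonal_mem_archLocal_diagonal L N α w _⟩ * u⁻¹) * g⁻¹ : archLocal L N (Matrix.diagonal α) w) : GL (Fin N) ℂ) : Matrix (Fin N) (Fin N) ℂ))) 0) ν :=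
  (continuous_iteratedDeriv_two_comp_conj_conj_wallLine L N α w Θ hΘ ζ i j u).integrable_of_hasCompactSupport
    (hasCompactSupport_iteratedDeriv_two_comp_conj_conj_wallLine L N α w hα hreal b hsign Θ hfc ζ hζ i j u)

end Integrable


/-! ## §2 The pointwise wall formula in Pauli form -/

section PauliForm

variable (L : Type) [Field L] (N : ℕ) (α : Fin N → L) (w : {w : InfinitePlace L // IsComplex w})
  {E : Type*} [NormedAddCommGroup E] [NormedSpace ℝ E]

/-- **THE POINTWISE WALL FORMULA IN PAULI FORM**: for `Θ` of class `C²`, `i ≠ j`, `ζ`-class of `i` equal to `{i,j}` and `m ∈ Z_{G_w}(t₀)`: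
`∂²_y|₀ Θ(↑↑(g·(m t_y m⁻¹)·g⁻¹)) = D²Θ(h_g)[ζ_i • ↑↑g (↑↑m y₁ ↑↑m⁻¹) ↑↑g⁻¹]² − DΘ(h_g)[ζ_i • Q_g]`, `y₁ = i(E_ii − E_jj)` (★ 2a pointwise formula; `h_{gm} = h_g`, `Q_{gm} = Q_g`,
`(iζ_i)•Ad(gm)(E_ii − E_jj) = ζ_i•Ad(g)Ad(m)y₁`). [cite: Rogawski1990, §8.4 p. 126] -/
theorem iteratedDeriv_two_comp_conj_conj_wallLine_eq_hessian_pauli_sub_gradient {i j : Fin N} (hij : i ≠ j) (ζ : Fin N → Circle)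
    (hS : ∀ k, ζ k = ζ i ↔ (k = i ∨ k = j)) (Θ : Matrix (Fin N) (Fin N) ℂ → E) (hΘ : ContDiff ℝ 2 Θ) (g m : archLocal L N (Matrix.diagonal α) w)
    (hm : m ∈ Subgroup.centralizer ({(⟨circleDiagonal N ζ, circleDiagonal_mem_archLocal_diagonal L N α w ζ⟩ : archLocal L N (Matrix.diagonal α) w)} :
      Set (archLocal L N (Matrix.diagonal α) w))) :
    iteratedDeriv 2 (fun y : ℝ =>
        Θ ((((g * (m * ⟨circleDiagonal N fun k => ζ k * Circle.exp (y * ((if k = i then 1 else 0) - (if k = j then 1 else 0))),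
          circleDiagonal_mem_archLocal_diagonal L N α w _⟩ * m⁻¹) * g⁻¹ : archLocal L N (Matrix.diagonal α) w) : GL (Fin N) ℂ) : Matrix (Fin N) (Fin N) ℂ))) 0 =
      iteratedFDeriv ℝ 2 Θ
          (((g * ⟨circleDiagonal N ζ, circleDiagonal_mem_archLocal_diagonal L N α w ζ⟩ * g⁻¹ : archLocal L N (Matrix.diagonal α) w) : GL (Fin N) ℂ) :
            Matrix (Fin N) (Fin N) ℂ)
          ![(ζ i : ℂ) • ((((g : archLocal L N (Matrix.diagonal α) w) : GL (Fin N) ℂ) : Matrix (Fin N) (Fin N) ℂ) *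
              ((((m : archLocal L N (Matrix.diagonal α) w) : GL (Fin N) ℂ) : Matrix (Fin N) (Fin N) ℂ) * (I • (Matrix.single i i (1 : ℂ) - Matrix.single j j 1)) *
                (((m⁻¹ : archLocal L N (Matrix.diagonal α) w) : GL (Fin N) ℂ) : Matrix (Fin N) (Fin N) ℂ)) *
              (((g⁻¹ : archLocal L N (Matrix.diagonal α) w) : GL (Fin N) ℂ) : Matrix (Fin N) (Fin N) ℂ)),
            (ζ i : ℂ) • ((((g : archLocal L N (Matrix.diagonal α) w) : GL (Fin N) ℂ) : Matrix (Fin N) (Fin N) ℂ) *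
              ((((m : archLocal L N (Matrix.diagonal α) w) : GL (Fin N) ℂ) : Matrix (Fin N) (Fin N) ℂ) * (I • (Matrix.single i i (1 : ℂ) - Matrix.single j j 1)) *
                (((m⁻¹ : archLocal L N (Matrix.diagonal α) w) : GL (Fin N) ℂ) : Matrix (Fin N) (Fin N) ℂ)) *
              (((g⁻¹ : archLocal L N (Matrix.diagonal α) w) : GL (Fin N) ℂ) : Matrix (Fin N) (Fin N) ℂ))] -
        fderiv ℝ Θ
          (((g * ⟨circleDiagonal N ζ, circleDiagonal_mem_archLocal_diagonal L N α w ζ⟩ * g⁻¹ : archLocal L N (Matrix.diagonal α) w) : GL (Fin N) ℂ) :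
            Matrix (Fin N) (Fin N) ℂ)
          ((ζ i : ℂ) • ((((g : archLocal L N (Matrix.diagonal α) w) : GL (Fin N) ℂ) : Matrix (Fin N) (Fin N) ℂ) * (Matrix.single i i (1 : ℂ) + Matrix.single j j 1) *
            (((g⁻¹ : archLocal L N (Matrix.diagonal α) w) : GL (Fin N) ℂ) : Matrix (Fin N) (Fin N) ℂ))) := by
  rw [iteratedDeriv_two_comp_conj_conj_circleDiagonal_wallLine_eq L N α w hij ζ Θ hΘ g m]
  have hζij : ζ i = ζ j := ((hS j).2 (Or.inr rfl)).symm
  have ht : (g * m) * (⟨circleDiagonal N ζ, circleDiagonal_mem_archLocal_diagonal L N α w ζ⟩ : archLocal L N (Matrix.diagonal α) w) * (g * m)⁻¹ =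
      g * ⟨circleDiagonal N ζ, circleDiagonal_mem_archLocal_diagonal L N α w ζ⟩ * g⁻¹ := by
    have hc : (⟨circleDiagonal N ζ, circleDiagonal_mem_archLocal_diagonal L N α w ζ⟩ : archLocal L N (Matrix.diagonal α) w) * m =
        m * ⟨circleDiagonal N ζ, circleDiagonal_mem_archLocal_diagonal L N α w ζ⟩ :=
      Subgroup.mem_centralizer_iff.1 hm _ (Set.mem_singleton _)
    rw [_root_.mul_inv_rev, mul_assoc g m, ← hc, ← mul_assoc, ← mul_assoc, mul_assoc (g * _) m, mul_inv_cancel, mul_one]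
  have hζj : ((ζ j : Circle) : ℂ) = (ζ i : ℂ) := by rw [hζij]
  have hgm : (((g * m : archLocal L N (Matrix.diagonal α) w) : GL (Fin N) ℂ) : Matrix (Fin N) (Fin N) ℂ) =
      (((g : archLocal L N (Matrix.diagonal α) w) : GL (Fin N) ℂ) : Matrix (Fin N) (Fin N) ℂ) * (((m : archLocal L N (Matrix.diagonal α) w) : GL (Fin N) ℂ) : Matrix (Fin N) (Fin N) ℂ) := by
    simp only [Subgroup.coe_mul, Units.val_mul]
  have hgm' : ((((g * m)⁻¹ : archLocal L N (Matrix.diagonal α) w) : GL (Fin N) ℂ) : Matrix (Fin N) (Fin N) ℂ) =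
      (((m⁻¹ : archLocal L N (Matrix.diagonal α) w) : GL (Fin N) ℂ) : Matrix (Fin N) (Fin N) ℂ) * (((g⁻¹ : archLocal L N (Matrix.diagonal α) w) : GL (Fin N) ℂ) : Matrix (Fin N) (Fin N) ℂ) := by
    rw [_root_.mul_inv_rev]; simp only [Subgroup.coe_mul, Units.val_mul]
  have hX : I • ((ζ i : ℂ) • ((((g * m : archLocal L N (Matrix.diagonal α) w) : GL (Fin N) ℂ) : Matrix (Fin N) (Fin N) ℂ) * Matrix.single i i (1 : ℂ) *
        ((((g * m)⁻¹ : archLocal L N (Matrix.diagonal α) w) : GL (Fin N) ℂ) : Matrix (Fin N) (Fin N) ℂ)) -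
      (ζ i : ℂ) • ((((g * m : archLocal L N (Matrix.diagonal α) w) : GL (Fin N) ℂ) : Matrix (Fin N) (Fin N) ℂ) * Matrix.single j j (1 : ℂ) *
        ((((g * m)⁻¹ : archLocal L N (Matrix.diagonal α) w) : GL (Fin N) ℂ) : Matrix (Fin N) (Fin N) ℂ))) =
      (ζ i : ℂ) • ((((g : archLocal L N (Matrix.diagonal α) w) : GL (Fin N) ℂ) : Matrix (Fin N) (Fin N) ℂ) *
        ((((m : archLocal L N (Matrix.diagonal α) w) : GL (Fin N) ℂ) : Matrix (Fin N) (Fin N) ℂ) * (I • (Matrix.single i i (1 : ℂ) - Matrix.single j j 1)) *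
          (((m⁻¹ : archLocal L N (Matrix.diagonal α) w) : GL (Fin N) ℂ) : Matrix (Fin N) (Fin N) ℂ)) *
        (((g⁻¹ : archLocal L N (Matrix.diagonal α) w) : GL (Fin N) ℂ) : Matrix (Fin N) (Fin N) ℂ)) := by
    rw [hgm, hgm']
    simp only [smul_sub, Matrix.mul_sub, Matrix.sub_mul, Matrix.mul_smul, Matrix.smul_mul, Matrix.mul_assoc, smul_smul, mul_comm I _]
  have hQ : (ζ i : ℂ) • ((((g * m : archLocal L N (Matrix.diagonal α) w) : GL (Fin N) ℂ) : Matrix (Fin N) (Fin N) ℂ) * Matrix.single i i (1 : ℂ) *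
        ((((g * m)⁻¹ : archLocal L N (Matrix.diagonal α) w) : GL (Fin N) ℂ) : Matrix (Fin N) (Fin N) ℂ)) +
      (ζ i : ℂ) • ((((g * m : archLocal L N (Matrix.diagonal α) w) : GL (Fin N) ℂ) : Matrix (Fin N) (Fin N) ℂ) * Matrix.single j j (1 : ℂ) *
        ((((g * m)⁻¹ : archLocal L N (Matrix.diagonal α) w) : GL (Fin N) ℂ) : Matrix (Fin N) (Fin N) ℂ)) =
      (ζ i : ℂ) • ((((g : archLocal L N (Matrix.diagonal α) w) : GL (Fin N) ℂ) : Matrix (Fin N) (Fin N) ℂ) * (Matrix.single i i (1 : ℂ) + Matrix.single j j 1) *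
        (((g⁻¹ : archLocal L N (Matrix.diagonal α) w) : GL (Fin N) ℂ) : Matrix (Fin N) (Fin N) ℂ)) := by
    rw [← smul_add, ← Matrix.add_mul, ← Matrix.mul_add, conj_mul_single_add_single_conj_eq_of_mem_centralizer L N α w ζ hij hS g m hm]
  rw [hζj, hX, hQ, ht]

end PauliForm

/-! ## §3 The frame elements `1, m₂, m₃ ∈ Z(t₀)` -/

section Frame

variable (L : Type) [Field L] (N : ℕ) (α : Fin N → L) (w : {w : InfinitePlace L // IsComplex w})

open Literature.LinearAlgebra.Matrix.SU2Block in
/-- **THE FRAME IS HOMOGENEOUS UNDER `Z(t₀)`**: at a compact-wall point (`i ≠ j`, `ζ_i = ζ_j`) with `σ_w(α_i) = σ_w(α_j)` there are `m₂, m₃ ∈ Z_{G_w}(t₀)` with `Ad(m₂) y₁ = y₃` and `Ad(m₃) y₁ = y₂`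
(the unitary block rotations `R(1∕√2)`, `S(1∕√2)` of 2b-I′, packaged as units with inverse `Rᴴ`, `Sᴴ`; membership in `G_w` = `H`-unitarity, in `Z(t₀)` = commuting with `diag ζ`).
[cite: Rogawski1990, §8.4 p. 126] -/
theorem exists_frame_rotations_mem_centralizer {i j : Fin N} (hij : i ≠ j)
    (hαij : w.1.embedding (α i) = w.1.embedding (α j)) (ζ : Fin N → Circle) (hζij : ζ i = ζ j) :
    ∃ m₂ m₃ : archLocal L N (Matrix.diagonal α) w,
      m₂ ∈ Subgroup.centralizer ({(⟨circleDiagonal N ζ, circleDiagonal_mem_archLocal_diagonal L N α w ζ⟩ : archLocal L N (Matrix.diagonal α) w)} :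
        Set (archLocal L N (Matrix.diagonal α) w)) ∧
      m₃ ∈ Subgroup.centralizer ({(⟨circleDiagonal N ζ, circleDiagonal_mem_archLocal_diagonal L N α w ζ⟩ : archLocal L N (Matrix.diagonal α) w)} :
        Set (archLocal L N (Matrix.diagonal α) w)) ∧
      (((m₂ : archLocal L N (Matrix.diagonal α) w) : GL (Fin N) ℂ) : Matrix (Fin N) (Fin N) ℂ) * (I • (Matrix.single i i (1 : ℂ) - Matrix.single j j 1)) *
          (((m₂⁻¹ : archLocal L N (Matrix.diagonal α) w) : GL (Fin N) ℂ) : Matrix (Fin N) (Fin N) ℂ) = I • (Matrix.single i j (1 : ℂ) + Matrix.single j i 1) ∧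
      (((m₃ : archLocal L N (Matrix.diagonal α) w) : GL (Fin N) ℂ) : Matrix (Fin N) (Fin N) ℂ) * (I • (Matrix.single i i (1 : ℂ) - Matrix.single j j 1)) *
          (((m₃⁻¹ : archLocal L N (Matrix.diagonal α) w) : GL (Fin N) ℂ) : Matrix (Fin N) (Fin N) ℂ) = Matrix.single i j (1 : ℂ) - Matrix.single j i 1 := by
  -- `c = 1/√2`
  obtain ⟨c, hc⟩ : ∃ c : ℝ, (c : ℂ) * c = 1 / 2 := by
    refine ⟨(Real.sqrt 2)⁻¹, ?_⟩
    rw [← Complex.ofReal_mul, ← mul_inv, Real.mul_self_sqrt (by norm_num : (0:ℝ) ≤ 2)]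
    push_cast; ring
  have hζ' : ((ζ i : Circle) : ℂ) = (ζ j : ℂ) := by rw [hζij]
  -- the form of `G_w` as a diagonal matrix
  have hform : (Matrix.diagonal α).map w.1.embedding = Matrix.diagonal fun k => w.1.embedding (α k) := Matrix.diagonal_map (map_zero _)
  have hT : ∀ M : Matrix (Fin N) (Fin N) ℂ, (M.map (starRingEnd ℂ))ᵀ = Mᴴ := fun M => rfl
  -- the first rotation
  obtain ⟨R, hR⟩ : ∃ R : Matrix (Fin N) (Fin N) ℂ, R = (1 : Matrix (Fin N) (Fin N) ℂ) - Matrix.single i i 1 - Matrix.single j j 1 +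
      (c : ℂ) • (Matrix.single i i 1 + Matrix.single j j 1 + Matrix.single j i 1 - Matrix.single i j 1) := ⟨_, rfl⟩
  have hRR : R * Rᴴ = 1 := by rw [hR]; exact rotation_mul_conjTranspose hij c hc
  have hRR' : Rᴴ * R = 1 := mul_eq_one_comm.1 hRR
  have hRmem : (⟨R, Rᴴ, hRR, hRR'⟩ : GL (Fin N) ℂ) ∈ archLocal L N (Matrix.diagonal α) w := by
    rw [mem_archLocal_iff, hform]
    show (R.map (starRingEnd ℂ))ᵀ * _ * R = _
    rw [hT, hR]
    exact conjTranspose_rotation_mul_diagonal_mul hij hαij c hc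
  -- the second rotation
  obtain ⟨S, hSdef⟩ : ∃ S : Matrix (Fin N) (Fin N) ℂ, S = (1 : Matrix (Fin N) (Fin N) ℂ) - Matrix.single i i 1 - Matrix.single j j 1 +
      (c : ℂ) • (Matrix.single i i 1 - Matrix.single i j 1) + (I * c) • (Matrix.single j i 1 + Matrix.single j j 1) := ⟨_, rfl⟩
  have hSS : S * Sᴴ = 1 := by rw [hSdef]; exact rotation'_mul_conjTranspose hij c hc
  have hSS' : Sᴴ * S = 1 := mul_eq_one_comm.1 hSS
  have hSmem : (⟨S, Sᴴ, hSS, hSS'⟩ : GL (Fin N) ℂ) ∈ archLocal L N (Matrix.diagonal α) w := by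
    rw [mem_archLocal_iff, hform]
    show (S.map (starRingEnd ℂ))ᵀ * _ * S = _
    rw [hT, hSdef]
    exact conjTranspose_rotation'_mul_diagonal_mul hij hαij c hc
  refine ⟨⟨_, hRmem⟩, ⟨_, hSmem⟩, ?_, ?_, ?_, ?_⟩
  · refine Subgroup.mem_centralizer_iff.2 fun t ht => ?_
    rw [Set.mem_singleton_iff.1 ht]
    apply Subtype.ext; apply Units.ext
    show Matrix.diagonal (fun k => (ζ k : ℂ)) * R = R * Matrix.diagonal (fun k => (ζ k : ℂ))
    rw [hR, rotation_mul_diagonal hζ']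
  · refine Subgroup.mem_centralizer_iff.2 fun t ht => ?_
    rw [Set.mem_singleton_iff.1 ht]
    apply Subtype.ext; apply Units.ext
    show Matrix.diagonal (fun k => (ζ k : ℂ)) * S = S * Matrix.diagonal (fun k => (ζ k : ℂ))
    rw [hSdef, rotation'_mul_diagonal hζ']
  · show R * _ * Rᴴ = _
    rw [hR, rotation_mul_frame_one hij, Matrix.mul_assoc, ← hR, hRR, Matrix.mul_one]
  · show S * _ * Sᴴ = _
    rw [hSdef, rotation'_mul_frame_one hij, Matrix.mul_assoc, ← hSdef, hSS, Matrix.mul_one]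

end Frame

end Literature.NumberTheory.Automorphic.UnitaryGroup

end
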